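import Literature.NumberTheory.Transcendental.CyclotomicSimplexRep
import Literature.NumberTheory.Transcendental.MZVSimplexRepFubini
import Literature.NumberTheory.Transcendental.KZSliceFubini
import Mathlib.MeasureTheory.Integral.DominatedConvergence
import Mathlib.Analysis.SpecificLimits.Normed
import HarnessLib

/-!
# The level-4 simplex representations compute the multiple polylogarithm values

Discharge of the named fact `Literature.NumberTheory.Transcendental.KZ.levelFourRep_value`
(`CyclotomicSimplexRep.lean`): for a convergent index `k = ((s₁,e₁),…,(s_ℓ,e_ℓ))`
(all `sⱼ ≥ 1`, `(s₁, i^{e₁}) ≠ (1, 1)`) the nested partial sums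
`∑_{N > n₁ > ⋯ > n_ℓ ≥ 1} ∏ⱼ i^{eⱼnⱼ}/nⱼ^{sⱼ}` of `Li_{s₁,…,s_ℓ}(i^{e₁},…,i^{e_ℓ})` converge, as
`N → ∞`, to `(-1)^ℓ ∫_{1 > t₀ > ⋯ > 0} ∏ⱼ dtⱼ/(tⱼ - wⱼ)` over the word
`W = 0^{s₁-1}a₁ ⋯ 0^{s_ℓ-1}a_ℓ`, `aⱼ = (x₁⋯xⱼ)⁻¹` [Zhao 2010, §1 eqs. (1)–(2)]; theorem
`KZ.levelFourRep_value_holds`. Theorems only.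

## Proof

The classical one-variable argument (the architecture of Zagier 1994, §9 for multiple zeta values,
here complex-valued and including the conditionally convergent case `s₁ = 1`, `x₁ ≠ 1`).
For an index `k` read with accumulated exponent `acc` (`ξ = i^{acc}`, word `wordAux acc k` with
poles `ξ⁻¹aⱼ`) and `0 < y ≤ 1` put
`P_N(ξy) = ∑_{N > n₁ > ⋯} (ξy)^{n₁} T_k(n)` (`T_k(n) = ∏ xⱼ^{nⱼ}/nⱼ^{sⱼ}`, twisted truncated sum)
and
`G(y) = (-1)^ℓ ∫_{y > t₀ > ⋯ > 0} ∏ (tⱼ - wⱼ)⁻¹` (signed iterated integral below `y`). We prove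
`P_N(ξy) → G(y)` whenever `y < 1`, or `y = 1` and the word is convergent
(`KZ.tendsto_twistedTrunc_cons`, `KZ.tendsto_twistedTrunc`), by induction on `k` and, for
`k = (s, e) :: k'`, on `s`:

* `s ≥ 2` (outermost letter `dt/t`): `P_N(ξy) = ∫₀ʸ P'_N(ξt) dt/t` with `P'` the sums of
  `(s-1, e) :: k'`; dominated convergence with the majorant `Λ_{(s-1,e)::k'}(t)/t`, whose integral
  is
  `∑ₙ ‖T_{(s,e)::k'}(n)‖ < ∞` (an admissible multiple zeta series, `summable_pi_fin_prod`,
  `prod_pow_inv_le_prod_rpow_inv`), and the slicing formula `G(y) = ∫₀ʸ G''(t) dt/t`.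
* `s = 1` (outermost letter the pole `a = (ξx)⁻¹`, `c = ξx = i^{acc+e}`):
  `P_N(ξy) = ∑_{M<N} (cy)^M Z_M(k')/M = ∫₀ʸ c ∑_{j<N-1} (ct)^j Z_{j+1}(k') dt` (`Z_M` the untwisted
  truncated sums of `k'`) and **Abel summation**
  `(1 - w) ∑_{j<M} w^j Z_{j+1} = P'_M(w) - w^M Z_M` (`LevelFour.abel_twistedTrunc`), so the
  integrand
  is `c/(1-ct) · (P'_M(ct) - (ct)^M Z_M)`, `M = N - 1`. The kernel `c/(1-ct) = -(t-a)⁻¹` is bounded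
  on
  `(0, y)` (`|1 - ct| ≥ 1 - y`, and `≥ 1` when `c ≠ 1`, which is the convergence condition on the
  word), `P'_M(ct) → G'(t)` by induction (`t < 1`), `(ct)^M Z_M → 0` (`|Z_M| ≤ M^ℓ`), everything is
  dominated by `2K Λ_{k'}(t)` with `∫₀¹ Λ_{k'} < ∞`; dominated convergence and slicing.

Ingredients proved here: absolute integrability of the word integrand on the simplex below `y < 1`
for every word not ending in `dt/t` (`KZ.integrableOn_levelFourProd_simplexLT`, domination as in
`KZ.integrableOn_openOrderedSimplex_of_norm_le`); the slicing formula
`∫_{y > t₀ > ⋯} f_{mW} = ∫_{(0,y)} (t₀ - pole m)⁻¹ ∫_{t₀ > ⋯} f_W` (`KZ.setIntegral_simplexLT_cons`,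
Fubini via `KZ.measurePreserving_vecCons`); the `ℝ≥0∞` majorants `Λ_k` and their integrals
(`KZ.lintegral_inv_mul_Lam`, `KZ.lintegral_Lam_lt_top`, using
`KZ.MZVSimplex.lintegral_inv_mul_tsum`);
the combinatorics of truncated sums (`LevelFour.twistedTrunc_cons`, `LevelFour.card_truncSet_le`).

## References

* J. Zhao, *Standard relations of multiple polylogarithm values at roots of unity*, Doc. Math. 15
  (2010) 1–34, arXiv:0707.1459: §1 eqs. (1)–(2) (series and iterated integral, `aⱼ = 1/(x₁⋯xⱼ)`;
  "a MPV converges if and only if `(s₁, μ^{i₁}) ≠ (1, 1)`"). [Zhao2010]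
* D. Zagier, *Values of zeta functions and their applications*, ECM 1992 (1994), §9 (the induction
  along the word for `Li_s(t)`). [Zagier1994]
-/

noncomputable section

open MeasureTheory Set Filter Complex
open scoped Topology ENNReal

namespace Literature.NumberTheory.Transcendental

namespace LevelFour

/-! ### Words of indices, unfolded -/

/-- `wordAux acc ((s + 1, e) :: k) = 4 :: wordAux acc ((s, e) :: k)` for `s ≥ 1`. [folklore] -/
theorem wordAux_cons_succ (acc e : Fin 4) (k : List (ℕ × Fin 4)) {s : ℕ} (hs : 1 ≤ s) :
    wordAux acc ((s + 1, e) :: k) = 4 :: wordAux acc ((s, e) :: k) := by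
  obtain ⟨s, rfl⟩ := Nat.exists_eq_add_of_le' hs
  rfl

/-- `wordAux acc [] = []`. [folklore] -/
theorem wordAux_nil (acc : Fin 4) : wordAux acc [] = [] := rfl

/-- The word of an index never ends with the letter `4` (the pole `0`). [folklore] -/
theorem getLast?_wordAux_ne (acc : Fin 4) (k : List (ℕ × Fin 4)) :
    (wordAux acc k).getLast? ≠ some 4 := by
  cases k with
  | nil => simp [wordAux]
  | cons p k =>
    obtain ⟨x, hx⟩ := getLast?_wordAux acc (List.cons_ne_nil p k)
    rw [hx]
    intro h
    simp only [Option.some.injEq] at h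
    exact absurd (congrArg Fin.val h) (by have := x.isLt; simp; omega)

/-! ### The general term under `Fin.cons` and raising the first exponent -/

/-- `T_{(s,e)::k}(M, n) = x^M / M^s · T_k(n)`, `x = i^e`. [folklore] -/
theorem polylogTerm_cons (s : ℕ) (e : Fin 4) (k : List (ℕ × Fin 4)) (M : ℕ)
    (n : Fin k.length → ℕ) :
    polylogTerm ((s, e) :: k) (Fin.cons M n) =
      (I ^ (e : ℕ)) ^ M / (M : ℂ) ^ s * polylogTerm k n := by
  simp only [polylogTerm, List.length_cons, Fin.prod_univ_succ, Fin.cons_zero, Fin.cons_succ]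
  rfl

/-- Raising the first exponent divides the general term by the first index:
`T_{(s+1,e)::k}(n) = T_{(s,e)::k}(n) / n₀`. [folklore] -/
theorem polylogTerm_succ_cons (s : ℕ) (e : Fin 4) (k : List (ℕ × Fin 4))
    (n : Fin (k.length + 1) → ℕ) :
    polylogTerm ((s + 1, e) :: k) n = polylogTerm ((s, e) :: k) n / (n 0 : ℂ) := by
  simp only [polylogTerm, Fin.prod_univ_succ, List.get_eq_getElem, Fin.val_zero, Fin.val_succ,
    List.getElem_cons_zero, List.getElem_cons_succ, List.length_cons, pow_succ]
  ring

/-- The norm of the general term: `‖T_k(n)‖ = ∏ⱼ nⱼ^{-sⱼ}` (the roots of unity have modulus one).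
[folklore] -/
theorem norm_polylogTerm (k : List (ℕ × Fin 4)) (n : Fin k.length → ℕ) :
    ‖polylogTerm k n‖ = ∏ j, ((n j : ℝ) ^ (k.get j).1)⁻¹ := by
  simp [polylogTerm, norm_prod]

/-- `‖T_{(s+1,e)::k}(n)‖ = ‖T_{(s,e)::k}(n)‖ / n₀`. [folklore] -/
theorem norm_polylogTerm_succ_cons (s : ℕ) (e : Fin 4) (k : List (ℕ × Fin 4))
    (n : Fin (k.length + 1) → ℕ) :
    ‖polylogTerm ((s + 1, e) :: k) n‖ = ‖polylogTerm ((s, e) :: k) n‖ / n 0 := by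
  rw [polylogTerm_succ_cons, norm_div, Complex.norm_natCast]

/-- The general term has modulus at most one on tuples of positive integers. [folklore] -/
theorem norm_polylogTerm_le_one (k : List (ℕ × Fin 4)) {n : Fin k.length → ℕ} (hn : ∀ i, 1 ≤ n i) :
    ‖polylogTerm k n‖ ≤ 1 := by
  rw [norm_polylogTerm]
  refine Finset.prod_le_one (fun j _ => inv_nonneg.2 (by positivity)) fun j _ => ?_
  exact inv_le_one_of_one_le₀ (one_le_pow₀ (by exact_mod_cast hn j))

/-! ### Truncated summation domains -/

/-- Entries of a tuple in `truncSet ℓ N` are `< N`. [folklore] -/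
theorem lt_of_mem_truncSet {ℓ N : ℕ} {n : Fin ℓ → ℕ} (hn : n ∈ MZV.truncSet ℓ N) (i : Fin ℓ) :
    n i < N :=
  (MZV.mem_truncSet_iff.1 hn).2 i

/-- Entries of a tuple in `truncSet ℓ N` are `≥ 1`. [folklore] -/
theorem one_le_of_mem_truncSet {ℓ N : ℕ} {n : Fin ℓ → ℕ} (hn : n ∈ MZV.truncSet ℓ N) (i : Fin ℓ) :
    1 ≤ n i :=
  (MZV.mem_truncSet_iff.1 hn).1.2 i

/-- The largest entry `max n = sup n` of a tuple in `truncSet ℓ N` is `≤ N - 1` (and `0` for the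
empty
tuple). [folklore] -/
theorem sup_le_of_mem_truncSet {ℓ N : ℕ} {n : Fin ℓ → ℕ} (hn : n ∈ MZV.truncSet ℓ N) :
    Finset.univ.sup n ≤ N - 1 :=
  Finset.sup_le fun i _ => Nat.le_sub_one_of_lt (lt_of_mem_truncSet hn i)

/-- The truncations increase with `N`. [folklore] -/
theorem truncSet_mono {ℓ N N' : ℕ} (h : N ≤ N') : MZV.truncSet ℓ N ⊆ MZV.truncSet ℓ N' :=
  fun _ hn => MZV.mem_truncSet_iff.2
    ⟨(MZV.mem_truncSet_iff.1 hn).1, fun i => (lt_of_mem_truncSet hn i).trans_le h⟩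

/-- A tuple that is new in `truncSet ℓ (N+1)` has largest entry exactly `N`. [folklore] -/
theorem sup_eq_of_mem_sdiff {ℓ N : ℕ} {n : Fin ℓ → ℕ}
    (hn : n ∈ MZV.truncSet ℓ (N + 1) \ MZV.truncSet ℓ N) : Finset.univ.sup n = N := by
  rw [Finset.mem_sdiff] at hn
  refine le_antisymm (by simpa using sup_le_of_mem_truncSet hn.1) ?_
  by_contra h
  push Not at h
  refine hn.2 (MZV.mem_truncSet_iff.2 ⟨(MZV.mem_truncSet_iff.1 hn.1).1, fun i => ?_⟩)
  exact (Finset.le_sup (f := n) (Finset.mem_univ i)).trans_lt h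

/-- For a strictly decreasing nonempty tuple the largest entry is the first one. [folklore] -/
theorem sup_eq_apply_zero {ℓ : ℕ} {n : Fin (ℓ + 1) → ℕ} (hn : n ∈ mzvIndexSet (ℓ + 1)) :
    Finset.univ.sup n = n 0 :=
  le_antisymm (Finset.sup_le fun i _ => hn.1.antitone (Fin.zero_le i))
    (Finset.le_sup (f := n) (Finset.mem_univ 0))

/-- `sup (M, n) = M` when all entries of `n` are below `M`. [folklore] -/
theorem sup_cons_eq {ℓ M : ℕ} {n : Fin ℓ → ℕ} (h : ∀ i, n i < M) :
    Finset.univ.sup (Fin.cons M n : Fin (ℓ + 1) → ℕ) = M := by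
  refine le_antisymm (Finset.sup_le fun i _ => ?_) ?_
  · induction i using Fin.cases with
    | zero => simp
    | succ i => simpa using (h i).le
  · simpa using Finset.le_sup (f := (Fin.cons M n : Fin (ℓ + 1) → ℕ)) (Finset.mem_univ 0)

/-- Summing over `truncSet (ℓ+1) N` = summing over the first entry and then over the truncation
below it (any additive commutative monoid). [folklore] -/
theorem sum_truncSet_succ' {A : Type*} [AddCommMonoid A] (ℓ N : ℕ) (f : (Fin (ℓ + 1) → ℕ) → A) :
    ∑ n ∈ MZV.truncSet (ℓ + 1) N, f n =
      ∑ m ∈ Finset.Ico 1 N, ∑ n ∈ MZV.truncSet ℓ m, f (Fin.cons m n) := by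
  rw [MZV.truncSet, Finset.sum_map, Finset.sum_sigma]
  rfl

/-- The number of tuples `N > n₁ > ⋯ > n_ℓ ≥ 1` is at most `N^ℓ`. [folklore] -/
theorem card_truncSet_le (ℓ N : ℕ) : (MZV.truncSet ℓ N).card ≤ N ^ ℓ := by
  induction ℓ generalizing N with
  | zero => simp [MZV.truncSet]
  | succ ℓ ih =>
    rw [MZV.truncSet, Finset.card_map, Finset.card_sigma]
    calc ∑ m ∈ Finset.Ico 1 N, (MZV.truncSet ℓ m).card ≤ ∑ m ∈ Finset.Ico 1 N, N ^ ℓ :=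
          Finset.sum_le_sum fun m hm => (ih m).trans
            (Nat.pow_le_pow_left (Finset.mem_Ico.1 hm).2.le _)
      _ ≤ N ^ (ℓ + 1) := by
          rw [Finset.sum_const, Nat.card_Ico, smul_eq_mul, pow_succ']
          exact Nat.mul_le_mul_right _ (Nat.sub_le N 1)

/-! ### Twisted truncated sums -/

/-- The truncated MPV sum has modulus at most `N^ℓ`. [folklore] -/
theorem norm_polylogTrunc_le (k : List (ℕ × Fin 4)) (N : ℕ) :
    ‖polylogTrunc k N‖ ≤ (N : ℝ) ^ k.length := by
  unfold polylogTrunc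
  calc ‖∑ n ∈ MZV.truncSet k.length N, polylogTerm k n‖
      ≤ ∑ n ∈ MZV.truncSet k.length N, (1 : ℝ) :=
        norm_sum_le_of_le _ fun n hn => norm_polylogTerm_le_one k (one_le_of_mem_truncSet hn)
    _ ≤ (N : ℝ) ^ k.length := by
        rw [Finset.sum_const, nsmul_eq_mul, mul_one]
        exact_mod_cast card_truncSet_le k.length N

/-- `w^N Z_N(k) → 0` for `‖w‖ < 1` (polynomial growth against geometric decay). [folklore] -/
theorem tendsto_pow_mul_polylogTrunc (k : List (ℕ × Fin 4)) {w : ℂ} (hw : ‖w‖ < 1) :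
    Tendsto (fun N => w ^ N * polylogTrunc k N) atTop (𝓝 0) := by
  have h := tendsto_pow_const_mul_const_pow_of_abs_lt_one k.length
    (show |‖w‖| < 1 by rwa [abs_norm])
  refine squeeze_zero_norm (fun N => ?_) h
  rw [norm_mul, norm_pow, mul_comm]
  exact mul_le_mul_of_nonneg_right (norm_polylogTrunc_le k N) (pow_nonneg (norm_nonneg _) _)

/-- Unfolding the twisted truncated sum of a nonempty index along the first summation variable:
`∑_{n} w^{n₁} T_{(s,e)::k}(n) = ∑_{1 ≤ M < N} (w x)^M M^{-s} Z_M(k)`, `x = i^e`. [folklore] -/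
theorem twistedTrunc_cons (s : ℕ) (e : Fin 4) (k : List (ℕ × Fin 4)) (N : ℕ) (w : ℂ) :
    ∑ n ∈ MZV.truncSet (k.length + 1) N, w ^ (Finset.univ.sup n) * polylogTerm ((s, e) :: k) n =
      ∑ M ∈ Finset.Ico 1 N, (w * I ^ (e : ℕ)) ^ M / (M : ℂ) ^ s * polylogTrunc k M := by
  rw [sum_truncSet_succ']
  refine Finset.sum_congr rfl fun M _ => ?_
  rw [polylogTrunc, Finset.mul_sum]
  refine Finset.sum_congr rfl fun n hn => ?_
  rw [sup_cons_eq (lt_of_mem_truncSet hn), polylogTerm_cons, mul_pow]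
  ring

/-- Enlarging the truncation from `N` to `N + 1` adds the tuples with first entry `N`:
`P_{N+1}(w) = P_N(w) + w^N (Z_{N+1} - Z_N)`. [folklore] -/
theorem twistedTrunc_succ (k : List (ℕ × Fin 4)) (N : ℕ) (w : ℂ) :
    ∑ n ∈ MZV.truncSet k.length (N + 1), w ^ (Finset.univ.sup n) * polylogTerm k n =
      ∑ n ∈ MZV.truncSet k.length N, w ^ (Finset.univ.sup n) * polylogTerm k n +
        w ^ N * (polylogTrunc k (N + 1) - polylogTrunc k N) := by
  have hsub : MZV.truncSet k.length N ⊆ MZV.truncSet k.length (N + 1) := truncSet_mono N.le_succ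
  rw [polylogTrunc, polylogTrunc, ← Finset.sum_sdiff hsub, ← Finset.sum_sdiff hsub,
    add_sub_cancel_right, Finset.mul_sum, add_comm]
  congr 1
  exact Finset.sum_congr rfl fun n hn => by rw [sup_eq_of_mem_sdiff hn]

/-- At `N = 0` the twist is invisible: `P_0(w) = Z_0(k)` (both are the empty sum, or `1` for the
empty index). [folklore] -/
theorem twistedTrunc_zero (k : List (ℕ × Fin 4)) (w : ℂ) :
    ∑ n ∈ MZV.truncSet k.length 0, w ^ (Finset.univ.sup n) * polylogTerm k n =
      polylogTrunc k 0 := by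
  rw [polylogTrunc]
  refine Finset.sum_congr rfl fun n hn => ?_
  rw [show Finset.univ.sup n = 0 from Nat.le_zero.1 (sup_le_of_mem_truncSet hn), pow_zero, one_mul]

/-- **Abel summation** for the truncated sums:
`(1 - w) ∑_{j < N} w^j Z_{j+1}(k) = P_N(w) - w^N Z_N(k)`, where `P_N(w) = ∑_n w^{n₁} T_k(n)` is the
twisted truncated sum. [folklore] -/
theorem abel_twistedTrunc (k : List (ℕ × Fin 4)) (w : ℂ) : ∀ N : ℕ,
    (1 - w) * ∑ j ∈ Finset.range N, w ^ j * polylogTrunc k (j + 1) =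
      (∑ n ∈ MZV.truncSet k.length N, w ^ (Finset.univ.sup n) * polylogTerm k n) -
        w ^ N * polylogTrunc k N
  | 0 => by simp [twistedTrunc_zero]
  | N + 1 => by
    rw [Finset.sum_range_succ, mul_add, abel_twistedTrunc k w N, twistedTrunc_succ]
    ring

/-- The twisted truncated sum is dominated termwise:
`‖P_N(w)‖ ≤ ∑_n ‖w‖^{n₁} ‖T_k(n)‖`. [folklore] -/
theorem norm_twistedTrunc_le (k : List (ℕ × Fin 4)) (N : ℕ) (w : ℂ) :
    ‖∑ n ∈ MZV.truncSet k.length N, w ^ (Finset.univ.sup n) * polylogTerm k n‖ ≤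
      ∑ n ∈ MZV.truncSet k.length N, ‖w‖ ^ (Finset.univ.sup n) * ‖polylogTerm k n‖ :=
  norm_sum_le_of_le _ fun n _ => by rw [norm_mul, norm_pow]

/-- The boundary term of the Abel summation is dominated by the same majorant:
`‖w^N Z_N(k)‖ ≤ ∑_n ‖w‖^{n₁} ‖T_k(n)‖` for `‖w‖ ≤ 1` (all `n₁ < N`). [folklore] -/
theorem norm_pow_mul_polylogTrunc_le (k : List (ℕ × Fin 4)) (N : ℕ) {w : ℂ} (hw : ‖w‖ ≤ 1) :
    ‖w ^ N * polylogTrunc k N‖ ≤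
      ∑ n ∈ MZV.truncSet k.length N, ‖w‖ ^ (Finset.univ.sup n) * ‖polylogTerm k n‖ := by
  rw [polylogTrunc, Finset.mul_sum]
  refine norm_sum_le_of_le _ fun n hn => ?_
  rw [norm_mul, norm_pow]
  exact mul_le_mul_of_nonneg_right
    (pow_le_pow_of_le_one (norm_nonneg _) hw ((sup_le_of_mem_truncSet hn).trans (Nat.sub_le N 1)))
    (norm_nonneg _)

/-! ### Roots of unity bookkeeping -/

/-- `‖i^n‖ = 1`. [folklore] -/
theorem norm_I_pow (n : ℕ) : ‖I ^ n‖ = 1 := by simp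

/-- The pole letter `castSucc (-m)` is the pole `i^{-m} = (i^m)⁻¹`. [folklore] -/
theorem levelFourPole_castSucc_neg (m : Fin 4) :
    KZ.levelFourPole (Fin.castSucc (-m)) = (I ^ (m : ℕ))⁻¹ := by
  fin_cases m
  · simp [KZ.levelFourPole]
  · have h : Fin.castSucc (-(1 : Fin 4)) = (3 : Fin 5) := by decide
    simp [h, KZ.levelFourPole]
  · have h : Fin.castSucc (-(2 : Fin 4)) = (2 : Fin 5) := by decide
    simp [h, KZ.levelFourPole]
  · have h : Fin.castSucc (-(3 : Fin 4)) = (1 : Fin 5) := by decide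
    simp [h, KZ.levelFourPole, pow_succ, Complex.inv_I]

/-- For a fourth root of unity `c = i^m ≠ 1` and real `t ≥ 0`: `‖1 - c t‖ ≥ 1`. [folklore] -/
theorem one_le_norm_one_sub_I_pow_mul {m : Fin 4} (hm : m ≠ 0) {t : ℝ} (ht : 0 ≤ t) :
    1 ≤ ‖1 - I ^ (m : ℕ) * (t : ℂ)‖ := by
  have key : ∀ j : ℕ, j = 1 ∨ j = 2 ∨ j = 3 → 1 ≤ ‖1 - I ^ j * (t : ℂ)‖ := by
    rintro j (rfl | rfl | rfl)
    · calc (1 : ℝ) = |(1 - I ^ 1 * (t : ℂ)).re| := by simp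
        _ ≤ _ := Complex.abs_re_le_norm _
    · have h : (1 : ℂ) - I ^ 2 * (t : ℂ) = ((1 + t : ℝ) : ℂ) := by
        rw [Complex.I_sq]; push_cast; ring
      rw [h, Complex.norm_real, Real.norm_eq_abs, abs_of_pos (by linarith)]
      linarith
    · calc (1 : ℝ) = |(1 - I ^ 3 * (t : ℂ)).re| := by simp [pow_succ]
        _ ≤ _ := Complex.abs_re_le_norm _
  apply key
  have := m.isLt
  have h0 : (m : ℕ) ≠ 0 := fun h => hm (Fin.ext h)
  omega

/-- For `‖c‖ = 1` and real `t`: `‖1 - c t‖ ≥ 1 - |t|`. [folklore] -/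
theorem one_sub_le_norm_one_sub_mul {c : ℂ} (hc : ‖c‖ = 1) (t : ℝ) (ht : 0 ≤ t) :
    1 - t ≤ ‖1 - c * (t : ℂ)‖ := by
  have := norm_sub_norm_le (1 : ℂ) (c * (t : ℂ))
  rw [norm_one, norm_mul, hc, one_mul, Complex.norm_real, Real.norm_eq_abs, abs_of_nonneg ht]
    at this
  exact this

end LevelFour


namespace KZ

variable {n : ℕ}

/-! ### The simplex below `y ≤ 1` and absolute convergence there -/

/-- The simplex below `y ≤ 1` lies in the open ordered simplex. [folklore] -/
theorem simplexLT_subset_openOrderedSimplex (w : ℕ) {y : ℝ} (hy : y ≤ 1) :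
    {τ : Fin w → ℝ | (∀ i, 0 < τ i) ∧ (∀ i, τ i < y) ∧ StrictAnti τ} ⊆ openOrderedSimplex w :=
  fun _ ht => ⟨ht.1, fun i => (ht.2.1 i).trans_le hy, ht.2.2⟩

/-- **Absolute convergence below `y < 1`, tuple form.** If the last letter is not the pole `0`,
`∏ⱼ (tⱼ - pole Lⱼ)⁻¹` is absolutely integrable on `y > t₀ > ⋯ > 0` for every `y < 1` (the pole
`1` is now harmless: `|tⱼ - 1|⁻¹ ≤ (1 - y)⁻¹`; domination as in
`integrableOn_openOrderedSimplex_of_norm_le`). [folklore] -/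
theorem integrableOn_levelFourProd_simplexLT (L : Fin n → Fin 5)
    (hlast : ∀ h : 0 < n, L ⟨n - 1, Nat.sub_one_lt_of_lt h⟩ ≠ 4) {y : ℝ} (hy0 : 0 < y)
    (hy1 : y < 1) : IntegrableOn (levelFourProd L) {τ : Fin n → ℝ | (∀ i, 0 < τ i) ∧ (∀ i, τ i < y)
        ∧ StrictAnti τ} volume := by
  rcases Nat.eq_zero_or_pos n with rfl | hn
  · have : IsFiniteMeasure (volume : Measure (Fin 0 → ℝ)) := by
      rw [volume_pi, Measure.pi_of_empty]; infer_instance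
    have h1 : levelFourProd L = fun _ => 1 := funext fun t => by simp [levelFourProd]
    rw [h1]
    exact integrableOn_const
  obtain ⟨k, rfl⟩ : ∃ k, n = k + 1 := ⟨n - 1, by omega⟩
  have hSm : MeasurableSet {τ : Fin (k + 1) → ℝ | (∀ i, 0 < τ i) ∧ (∀ i, τ i < y)
      ∧ StrictAnti τ} := MZVSimplex.measurableSet_simplexLT _ _
  have hsub : {τ : Fin (k + 1) → ℝ | (∀ i, 0 < τ i) ∧ (∀ i, τ i < y)
      ∧ StrictAnti τ} ⊆ openOrderedSimplex (k + 1) :=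
    simplexLT_subset_openOrderedSimplex _ hy1.le
  have hy' : 0 < 1 - y := sub_pos.2 hy1
  set C : ℝ := (1 - y)⁻¹ ^ (k + 1) with hC
  have hC0 : 0 < C := pow_pos (inv_pos.2 hy') _
  have hCinv1 : 1 ≤ (1 - y)⁻¹ := (one_le_inv₀ hy').2 (by linarith)
  set g : (Fin (k + 1) → ℝ) → ℂ := ({τ : Fin (k + 1) → ℝ | (∀ i, 0 < τ i) ∧ (∀ i, τ i < y)
      ∧ StrictAnti τ}).indicator (levelFourProd L) with hg
  have hZ : Fin.last k ∉ Finset.univ.filter (fun i => L i = 4) := by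
    have : L (Fin.last k) ≠ 4 := by
      convert hlast (Nat.succ_pos k) using 2
      exact Fin.ext (by simp)
    simpa using this
  have hF : IntegrableOn (fun t => C⁻¹ • g t) (openOrderedSimplex (k + 1)) volume := by
    refine integrableOn_openOrderedSimplex_of_norm_le (fun t => C⁻¹ • g t)
      (((measurable_levelFourProd L).indicator hSm).const_smul C⁻¹).aestronglyMeasurable
      ∅ (Finset.univ.filter fun i => L i = 4) (Finset.notMem_empty _) hZ fun t ht => ?_
    rw [Finset.prod_empty, one_mul, norm_smul, norm_inv, Real.norm_eq_abs, abs_of_pos hC0]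
    have hZnn : 0 ≤ ∏ i ∈ Finset.univ.filter (fun i => L i = 4), (t i)⁻¹ :=
      Finset.prod_nonneg fun i _ => (inv_pos.2 (ht.1 i)).le
    by_cases hts : t ∈ {τ : Fin (k + 1) → ℝ | (∀ i, 0 < τ i) ∧ (∀ i, τ i < y) ∧ StrictAnti τ}
    · rw [hg, indicator_of_mem hts]
      have hCprod : C = ∏ _i : Fin (k + 1), (1 - y)⁻¹ := by
        rw [Finset.prod_const, Finset.card_univ, Fintype.card_fin]
      have hb : ‖levelFourProd L t‖ ≤ C * ∏ i ∈ Finset.univ.filter (fun i => L i = 4), (t i)⁻¹ := by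
        rw [levelFourProd, norm_prod, Finset.prod_filter, hCprod, ← Finset.prod_mul_distrib]
        refine Finset.prod_le_prod (fun i _ => norm_nonneg _) fun i _ => ?_
        refine (norm_levelFourFactor_le (L i) (ht.1 i) (ht.2.1 i)).trans ?_
        refine mul_le_mul ?_ le_rfl ?_ (inv_pos.2 hy').le
        · split_ifs
          · exact inv_anti₀ hy' (by linarith [hts.2.1 i])
          · exact hCinv1
        · split_ifs
          · exact (inv_pos.2 (ht.1 i)).le
          · exact zero_le_one
      calc C⁻¹ * ‖levelFourProd L t‖
          ≤ C⁻¹ * (C * ∏ i ∈ Finset.univ.filter (fun i => L i = 4), (t i)⁻¹) :=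
            mul_le_mul_of_nonneg_left hb (inv_pos.2 hC0).le
        _ = _ := by rw [← mul_assoc, inv_mul_cancel₀ hC0.ne', one_mul]
    · rw [hg, indicator_of_notMem hts, norm_zero, mul_zero]
      exact hZnn
  have hg' : IntegrableOn g (openOrderedSimplex (k + 1)) volume :=
    (integrable_smul_iff (inv_ne_zero hC0.ne') g).1 hF
  exact (hg'.mono_set hsub).congr_fun (fun t ht => by rw [hg, indicator_of_mem ht]) hSm

/-- **Absolute convergence below `y < 1` for words** not ending with the letter `4`. [folklore] -/
theorem integrableOn_levelFourIntegrandC_simplexLT {W : List (Fin 5)} (hW : W.getLast? ≠ some 4)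
    {y : ℝ} (hy0 : 0 < y) (hy1 : y < 1) :
    IntegrableOn (levelFourIntegrandC W) {τ : Fin W.length → ℝ | (∀ i, 0 < τ i) ∧ (∀ i, τ i < y)
        ∧ StrictAnti τ} volume := by
  refine integrableOn_levelFourProd_simplexLT W.get (fun _ h4 => hW ?_) hy0 hy1
  rw [List.getLast?_eq_getElem?, List.getElem?_eq_getElem (by omega)]
  simpa [List.get_eq_getElem] using h4

/-- **Absolute convergence of the integrand of the word of an index below `y`**: for `y < 1`
unconditionally, and for `y ≤ 1` when the word is convergent. [folklore] -/
theorem integrableOn_wordAux (acc : Fin 4) (k : List (ℕ × Fin 4)) {y : ℝ} (hy0 : 0 < y)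
    (hy1 : y ≤ 1) (h : y < 1 ∨ LevelFour.IsConvergent (LevelFour.wordAux acc k)) :
    IntegrableOn (levelFourIntegrandC (LevelFour.wordAux acc k))
      {τ : Fin ((LevelFour.wordAux acc k).length) → ℝ | (∀ i, 0 < τ i) ∧ (∀ i, τ i < y)
          ∧ StrictAnti τ} volume := by
  rcases h with hy | hconv
  · exact integrableOn_levelFourIntegrandC_simplexLT (LevelFour.getLast?_wordAux_ne acc k) hy0 hy
  · exact (integrableOn_levelFourIntegrandC hconv).mono_set
      (simplexLT_subset_openOrderedSimplex _ hy1)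

/-! ### Slicing the iterated integral along the outermost variable -/

/-- Splitting off the outermost factor of the tuple integrand at `(t₀, x)`. [folklore] -/
theorem levelFourProd_cons {n : ℕ} (L : Fin (n + 1) → Fin 5) (t₀ : ℝ) (x : Fin n → ℝ) :
    levelFourProd L (Fin.cons t₀ x) =
      levelFourFactor (L 0) t₀ * levelFourProd (fun j => L j.succ) x := by
  simp [levelFourProd, Fin.prod_univ_succ]

/-- Splitting off the outermost factor of the word integrand: for `W = m W'`,
`f_W(t₀, x) = (t₀ - pole m)⁻¹ f_{W'}(x)`. [folklore] -/
theorem levelFourIntegrandC_cons (m : Fin 5) (W : List (Fin 5)) (t₀ : ℝ) (x : Fin W.length → ℝ) :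
    levelFourIntegrandC (m :: W) (Fin.cons t₀ x) = levelFourFactor m t₀ * levelFourIntegrandC W x :=
  levelFourProd_cons (n := W.length) (m :: W).get t₀ x

/-- **Slicing** (Fubini along the outermost variable, `MeasureTheory.integral_prod` transported by
`(t₀, x) ↦ (t₀, x₀, …)`): for an absolutely integrable word integrand,
`∫_{y > t₀ > ⋯ > 0} f_{mW}(t) dt = ∫_{(0,y)} (t₀ - pole m)⁻¹ (∫_{t₀ > ⋯ > 0} f_W) dt₀` — the
recursion `∫₀ʸ w ∘ f = ∫₀ʸ w(t₀) ∫₀^{t₀} f` of iterated integrals. [cite: Zhao2010, §1 eq. (2)] -/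
theorem setIntegral_simplexLT_cons (m : Fin 5) (W : List (Fin 5)) (y : ℝ)
    (hint : IntegrableOn (levelFourIntegrandC (m :: W)) {τ : Fin ((m :: W).length) → ℝ | (∀ i, 0
        < τ i) ∧ (∀ i, τ i < y) ∧ StrictAnti τ} volume) :
    ∫ t in {τ : Fin ((m :: W).length) → ℝ | (∀ i, 0 < τ i) ∧ (∀ i, τ i < y) ∧ StrictAnti τ},
        levelFourIntegrandC (m :: W) t =
      ∫ t₀ in Ioo 0 y, levelFourFactor m t₀ * ∫ t in {τ : Fin W.length → ℝ | (∀ i, 0 < τ i)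
          ∧ (∀ i, τ i < t₀) ∧ StrictAnti τ}, levelFourIntegrandC W t := by
  change IntegrableOn (levelFourIntegrandC (m :: W)) {τ : Fin (W.length + 1) → ℝ | (∀ i, 0 < τ i)
      ∧ (∀ i, τ i < y) ∧ StrictAnti τ} volume at hint
  show ∫ t in {τ : Fin (W.length + 1) → ℝ | (∀ i, 0 < τ i) ∧ (∀ i, τ i < y) ∧ StrictAnti τ},
      levelFourIntegrandC (m :: W) t = _
  set S : Set (Fin (W.length + 1) → ℝ) := {τ : Fin (W.length + 1) → ℝ | (∀ i, 0 < τ i) ∧ (∀ i, τ i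
      < y) ∧ StrictAnti τ} with hS
  have hSm : MeasurableSet S := MZVSimplex.measurableSet_simplexLT _ _
  set F : (Fin (W.length + 1) → ℝ) → ℂ := S.indicator (levelFourIntegrandC (m :: W)) with hF
  have hFint : Integrable F volume := (integrable_indicator_iff hSm).2 hint
  have hslice : ∀ t₀ : ℝ, ∫ x, F (Matrix.vecCons t₀ x) =
      (Ioo 0 y).indicator (fun t₀ => levelFourFactor m t₀ *
        ∫ t in {τ : Fin W.length → ℝ | (∀ i, 0 < τ i) ∧ (∀ i, τ i < t₀) ∧ StrictAnti τ},
            levelFourIntegrandC W t) t₀ := by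
    intro t₀
    by_cases h₀ : t₀ ∈ Ioo 0 y
    · rw [indicator_of_mem h₀]
      have hpt : ∀ x : Fin W.length → ℝ, F (Matrix.vecCons t₀ x) =
          ({τ : Fin W.length → ℝ | (∀ i, 0 < τ i) ∧ (∀ i, τ i < t₀) ∧ StrictAnti τ}).indicator
            (fun x => levelFourFactor m t₀ * levelFourIntegrandC W x) x := by
        intro x
        by_cases hx : x ∈ {τ : Fin W.length → ℝ | (∀ i, 0 < τ i) ∧ (∀ i, τ i < t₀) ∧ StrictAnti τ}
        · rw [indicator_of_mem hx, hF]
          show S.indicator (levelFourIntegrandC (m :: W)) (Fin.cons t₀ x) = _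
          rw [indicator_of_mem (MZVSimplex.cons_mem_simplexLT.2 ⟨h₀, hx⟩)]
          exact levelFourIntegrandC_cons m W t₀ x
        · rw [indicator_of_notMem hx, hF]
          show S.indicator (levelFourIntegrandC (m :: W)) (Fin.cons t₀ x) = _
          rw [indicator_of_notMem]
          exact fun h => hx (MZVSimplex.cons_mem_simplexLT.1 h).2
      simp_rw [hpt]
      rw [integral_indicator (MZVSimplex.measurableSet_simplexLT _ _), integral_const_mul]
    · rw [indicator_of_notMem h₀]
      have hpt : ∀ x : Fin W.length → ℝ, F (Matrix.vecCons t₀ x) = 0 := fun x => by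
        rw [hF]
        show S.indicator (levelFourIntegrandC (m :: W)) (Fin.cons t₀ x) = 0
        rw [indicator_of_notMem]
        exact fun h => h₀ (MZVSimplex.cons_mem_simplexLT.1 h).1
      simp_rw [hpt]
      exact integral_zero _ _
  calc ∫ t in S, levelFourIntegrandC (m :: W) t = ∫ z, F z := (integral_indicator hSm).symm
    _ = ∫ p : ℝ × (Fin W.length → ℝ), F (Matrix.vecCons p.1 p.2)
          ∂((volume : Measure ℝ).prod (volume : Measure (Fin W.length → ℝ))) :=
        (measurePreserving_vecCons.integral_comp measurableEmbedding_vecCons F).symm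
    _ = ∫ t₀, ∫ x, F (Matrix.vecCons t₀ x) :=
        integral_prod _
          ((measurePreserving_vecCons.integrable_comp_emb measurableEmbedding_vecCons).2 hFint)
    _ = ∫ t₀, (Ioo 0 y).indicator (fun t₀ => levelFourFactor m t₀ *
          ∫ t in {τ : Fin W.length → ℝ | (∀ i, 0 < τ i) ∧ (∀ i, τ i < t₀) ∧ StrictAnti τ},
              levelFourIntegrandC W t) t₀ :=
        integral_congr_ae (ae_of_all _ hslice)
    _ = _ := integral_indicator measurableSet_Ioo

/-- In dimension `0` the iterated integral is `1` (tuple form). [folklore] -/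
theorem setIntegral_levelFourProd_fin_zero (L : Fin 0 → Fin 5) (y : ℝ) :
    ∫ t in {τ : Fin 0 → ℝ | (∀ i, 0 < τ i) ∧ (∀ i, τ i < y)
        ∧ StrictAnti τ}, levelFourProd L t = 1 := by
  have hS : {τ : Fin 0 → ℝ | (∀ i, 0 < τ i) ∧ (∀ i, τ i < y) ∧ StrictAnti τ} = univ := by
    ext t
    simp only [mem_setOf_eq, IsEmpty.forall_iff, true_and, mem_univ, iff_true]
    exact fun i => i.elim0
  have h1 : levelFourProd L = fun _ => (1 : ℂ) := funext fun t => by simp [levelFourProd]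
  rw [hS, Measure.restrict_univ, h1, volume_pi,
    Measure.pi_of_empty (fun _ => (volume : Measure ℝ)) (fun i => i.elim0), integral_dirac]

/-- The letter `4` is the form `dt/t`: `re₄ + i·im₄ = t⁻¹`. [folklore] -/
theorem levelFourFactor_four (t : ℝ) : levelFourFactor 4 t = ((t⁻¹ : ℝ) : ℂ) := by
  simp [levelFourFactor]

/-- The pole letter `a = i^{-m}` as a geometric kernel: `(t - a)⁻¹ = -c/(1 - c t)`, `c = i^m = ā`
(both sides are `0` at the junk point `c t = 1`). [folklore] -/
theorem levelFourFactor_castSucc_neg (m : Fin 4) (t : ℝ) :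
    levelFourFactor (Fin.castSucc (-m)) t = -(I ^ (m : ℕ) / (1 - I ^ (m : ℕ) * t)) := by
  rw [levelFourFactor_eq, LevelFour.levelFourPole_castSucc_neg]
  have hc : (I : ℂ) ^ (m : ℕ) ≠ 0 := pow_ne_zero _ I_ne_zero
  have : (t : ℂ) - (I ^ (m : ℕ))⁻¹ = -((I ^ (m : ℕ))⁻¹ * (1 - I ^ (m : ℕ) * t)) := by
    field_simp
    ring
  rw [this, inv_neg, mul_inv, inv_inv, div_eq_mul_inv]

/-! ### The majorant series `Λ_k(t) = ∑ₙ ‖T_k(n)‖ t^{n₁}` (in `ℝ≥0∞`) -/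

/-- The majorant is a measurable function of `t`. [folklore] -/
theorem measurable_Lam (k : List (ℕ × Fin 4)) : Measurable fun t : ℝ =>
    (∑' n : ↥(mzvIndexSet (List.length k)), ENNReal.ofReal ‖LevelFour.polylogTerm k n.1‖
    * ENNReal.ofReal (t ^ (Finset.univ.sup n.1))) :=
  Measurable.tsum fun _ => (MZVSimplex.measurable_ofReal_pow _).const_mul _

/-- **Absolute convergence of the majorant series with first exponent `≥ 2`**:
`∑ₙ ‖T_{(s,e)::k}(n)‖ < ∞` for `s ≥ 2` — domination by `∏ᵢ nᵢ^{-(1+1/ℓ)}` exactly as for the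
multiple zeta series (`summable_of_isAdmissible_holds`). [cite: Zhao2010, §1] -/
theorem summable_norm_polylogTerm {s : ℕ} (hs : 2 ≤ s) (e : Fin 4) {k : List (ℕ × Fin 4)}
    (hk : ∀ p ∈ k, 1 ≤ p.1) :
    Summable fun n : mzvIndexSet (k.length + 1) => ‖LevelFour.polylogTerm ((s, e) :: k) n.1‖ := by
  set E : Fin (k.length + 1) → ℕ := fun j => (((s, e) :: k).get j).1 with hE
  have hE1 : ∀ j, 1 ≤ E j := fun j => by
    induction j using Fin.cases with
    | zero => simp only [hE]; exact le_trans (by norm_num) hs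
    | succ j => exact hk _ (List.get_mem k j)
  have hE0 : 2 ≤ E 0 := hs
  have hp : 1 < 1 + ((k.length + 1 : ℕ) : ℝ)⁻¹ := lt_add_of_pos_right _ (by positivity)
  have hg0 : ∀ m : ℕ, 0 ≤ ((m : ℝ) ^ (1 + ((k.length + 1 : ℕ) : ℝ)⁻¹))⁻¹ := fun m =>
    inv_nonneg.2 (Real.rpow_nonneg (Nat.cast_nonneg _) _)
  have hG := (summable_pi_fin_prod (k := k.length + 1) (Real.summable_nat_rpow_inv.2 hp)
    hg0).subtype (mzvIndexSet (k.length + 1))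
  refine Summable.of_nonneg_of_le (fun n => norm_nonneg _) (fun n => ?_) hG
  rw [LevelFour.norm_polylogTerm]
  exact prod_pow_inv_le_prod_rpow_inv E n.1 0 hE1 hE0 (fun i => n.2.2 i)
    fun i => n.2.1.antitone (Fin.zero_le i)

/-- The same in `ℝ≥0∞`: `∑ₙ ‖T_{(s,e)::k}(n)‖ < ∞` for `s ≥ 2`. [folklore] -/
theorem tsum_ofReal_norm_polylogTerm_lt_top {s : ℕ} (hs : 2 ≤ s) (e : Fin 4)
    {k : List (ℕ × Fin 4)} (hk : ∀ p ∈ k, 1 ≤ p.1) :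
    ∑' n : mzvIndexSet (k.length + 1), ENNReal.ofReal ‖LevelFour.polylogTerm ((s, e) :: k) n.1‖ <
      ⊤ := by
  rw [← ENNReal.ofReal_tsum_of_nonneg (fun _ => norm_nonneg _) (summable_norm_polylogTerm hs e hk)]
  exact ENNReal.ofReal_lt_top

/-- **The letter `0` on the majorant** (monotone convergence, `lintegral_inv_mul_tsum`):
`∫₀¹ Λ_{(s,e)::k}(t) dt/t = ∑ₙ ‖T_{(s+1,e)::k}(n)‖`. [folklore] -/
theorem lintegral_inv_mul_Lam (s : ℕ) (e : Fin 4) (k : List (ℕ × Fin 4)) :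
    ∫⁻ t in Ioo 0 1, ENNReal.ofReal (1 / t) * (∑' n : ↥(mzvIndexSet (List.length (((s, e) :: k)))),
        ENNReal.ofReal ‖LevelFour.polylogTerm (((s, e) :: k)) n.1‖
        * ENNReal.ofReal (t ^ (Finset.univ.sup n.1))) =
      ∑' n : mzvIndexSet (List.length ((s, e) :: k)),
        ENNReal.ofReal ‖LevelFour.polylogTerm ((s + 1, e) :: k) n.1‖ := by
  have hsup : ∀ n : mzvIndexSet (List.length ((s, e) :: k)), Finset.univ.sup n.1 = n.1 0 :=
    fun n => LevelFour.sup_eq_apply_zero n.2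
  have hN : ∀ n : mzvIndexSet (List.length ((s, e) :: k)), 1 ≤ Finset.univ.sup n.1 := fun n => by
    rw [hsup]; exact n.2.2 0
  rw [MZVSimplex.lintegral_inv_mul_tsum _ _ hN zero_le_one]
  refine tsum_congr fun n => ?_
  rw [one_pow, ← ENNReal.ofReal_mul (norm_nonneg _), LevelFour.norm_polylogTerm_succ_cons, hsup,
    mul_one_div]

/-- `T_∅ = 1`. [folklore] -/
theorem polylogTerm_nil (n : Fin 0 → ℕ) : LevelFour.polylogTerm [] n = 1 := Fin.prod_univ_zero _

/-- The empty tuple has largest entry `0` (junk value `sup ∅ = ⊥`). [folklore] -/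
theorem sup_fin_zero (n : Fin 0 → ℕ) : Finset.univ.sup n = 0 := by
  simp [Finset.univ_eq_empty]

/-- `Λ_∅(t) = 1`. [folklore] -/
theorem Lam_nil (t : ℝ) : (∑' n : ↥(mzvIndexSet (List.length (([] : List (ℕ × Fin 4))))),
    ENNReal.ofReal ‖LevelFour.polylogTerm (([] : List (ℕ × Fin 4))) n.1‖
    * ENNReal.ofReal (t ^ (Finset.univ.sup n.1))) = 1 := by
  have hmem : (Fin.elim0 : Fin 0 → ℕ) ∈ mzvIndexSet 0 := ⟨fun i => i.elim0, fun i => i.elim0⟩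
  show ∑' n : ↥(mzvIndexSet 0), ENNReal.ofReal ‖LevelFour.polylogTerm [] n.1‖ *
    ENNReal.ofReal (t ^ (Finset.univ.sup n.1)) = 1
  rw [tsum_eq_single (⟨Fin.elim0, hmem⟩ : ↥(mzvIndexSet 0)) fun n hn =>
    absurd (Subtype.ext (funext fun i => i.elim0)) hn]
  rw [polylogTerm_nil, sup_fin_zero, norm_one, pow_zero, ENNReal.ofReal_one, mul_one]

/-- **The majorant is integrable on `(0, 1)`**: `∫₀¹ Λ_k(t) dt < ∞` (bounded by
`∫₀¹ Λ_k(t) dt/t = ∑ ‖T_{(s₁+1)…}‖`, an admissible, hence convergent, series). [folklore] -/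
theorem lintegral_Lam_lt_top (k : List (ℕ × Fin 4)) (hk : ∀ p ∈ k, 1 ≤ p.1) :
    ∫⁻ t in Ioo 0 1, (∑' n : ↥(mzvIndexSet (List.length k)),
        ENNReal.ofReal ‖LevelFour.polylogTerm k n.1‖ * ENNReal.ofReal (t ^ (Finset.univ.sup n.1)))
        < ⊤ := by
  cases k with
  | nil =>
    simp_rw [Lam_nil]
    rw [setLIntegral_const]
    simp
  | cons q k =>
    obtain ⟨s, e⟩ := q
    have hs : 1 ≤ s := hk (s, e) (by simp)
    have hk' : ∀ p ∈ k, 1 ≤ p.1 := fun p hp => hk p (List.mem_cons_of_mem _ hp)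
    calc ∫⁻ t in Ioo 0 1, (∑' n : ↥(mzvIndexSet (List.length (((s, e) :: k)))),
        ENNReal.ofReal ‖LevelFour.polylogTerm (((s, e) :: k)) n.1‖
        * ENNReal.ofReal (t ^ (Finset.univ.sup n.1)))
        ≤ ∫⁻ t in Ioo 0 1, ENNReal.ofReal (1 / t) *
            (∑' n : ↥(mzvIndexSet (List.length (((s, e) :: k)))),
            ENNReal.ofReal ‖LevelFour.polylogTerm (((s, e) :: k)) n.1‖
            * ENNReal.ofReal (t ^ (Finset.univ.sup n.1))) :=
          setLIntegral_mono' measurableSet_Ioo fun t ht =>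
            le_mul_of_one_le_left zero_le (ENNReal.one_le_ofReal.2 (one_le_one_div ht.1 ht.2.le))
      _ = _ := lintegral_inv_mul_Lam s e k
      _ < ⊤ := tsum_ofReal_norm_polylogTerm_lt_top (by omega) e hk'

/-- **The truncated majorant is below the full one**:
`∑_{n ∈ truncSet} t^{n₁} ‖T_k(n)‖ ≤ Λ_k(t)` (as a real number, when `Λ_k(t) < ∞`). [folklore] -/
theorem sum_le_Lam_toReal (k : List (ℕ × Fin 4)) (N : ℕ) {t : ℝ} (ht : 0 ≤ t)
    (hfin : (∑' n : ↥(mzvIndexSet (List.length k)), ENNReal.ofReal ‖LevelFour.polylogTerm k n.1‖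
        * ENNReal.ofReal (t ^ (Finset.univ.sup n.1))) ≠ ⊤) :
    ∑ n ∈ MZV.truncSet k.length N, t ^ (Finset.univ.sup n) * ‖LevelFour.polylogTerm k n‖ ≤
      ((∑' n : ↥(mzvIndexSet (List.length k)), ENNReal.ofReal ‖LevelFour.polylogTerm k n.1‖
          * ENNReal.ofReal (t ^ (Finset.univ.sup n.1)))).toReal := by
  classical
  rw [← ENNReal.ofReal_le_iff_le_toReal hfin,
    ENNReal.ofReal_sum_of_nonneg (fun n _ => mul_nonneg (pow_nonneg ht _) (norm_nonneg _))]
  calc ∑ n ∈ MZV.truncSet k.length N,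
        ENNReal.ofReal (t ^ Finset.univ.sup n * ‖LevelFour.polylogTerm k n‖)
      = ∑ n ∈ (MZV.truncSet k.length N).subtype (· ∈ mzvIndexSet k.length),
          ENNReal.ofReal ‖LevelFour.polylogTerm k n.1‖ *
            ENNReal.ofReal (t ^ Finset.univ.sup n.1) := by
        rw [Finset.sum_subtype_of_mem (f := fun n : Fin k.length → ℕ =>
            ENNReal.ofReal ‖LevelFour.polylogTerm k n‖ * ENNReal.ofReal (t ^ Finset.univ.sup n))
            (fun n hn => (MZV.mem_truncSet_iff.1 hn).1)]
        exact Finset.sum_congr rfl fun n _ => by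
          rw [ENNReal.ofReal_mul (pow_nonneg ht _), mul_comm]
    _ ≤ (∑' n : ↥(mzvIndexSet (List.length k)), ENNReal.ofReal ‖LevelFour.polylogTerm k n.1‖
        * ENNReal.ofReal (t ^ (Finset.univ.sup n.1))) := ENNReal.sum_le_tsum _


/-! ### One-variable integrals of monomials -/

/-- `∫_{(0,y)} tⁿ dt = y^{n+1}/(n+1)` for complex-valued monomials of a real variable. [folklore] -/
theorem integral_ofReal_pow_Ioo (n : ℕ) {y : ℝ} (hy : 0 ≤ y) :
    ∫ t in Ioo (0 : ℝ) y, ((t : ℝ) : ℂ) ^ n = (y : ℂ) ^ (n + 1) / ((n : ℂ) + 1) := by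
  have h1 : ∫ t in Ioo (0 : ℝ) y, ((t : ℝ) : ℂ) ^ n = ((∫ t in Ioo (0 : ℝ) y, t ^ n : ℝ) : ℂ) := by
    rw [← integral_complex_ofReal]
    simp only [Complex.ofReal_pow]
  rw [h1, ← integral_Ioc_eq_integral_Ioo, ← intervalIntegral.integral_of_le hy, integral_pow]
  push_cast
  rw [zero_pow (Nat.succ_ne_zero n), sub_zero]

/-! ### The induction: twisted truncated sums converge to the iterated integrals

For an index `k` read with accumulated exponent `acc` (`ξ = i^{acc}`) and `0 < y ≤ 1` write
`P_N(ξ y) = ∑_{N > n₁ > ⋯} (ξ y)^{n₁} T_k(n)` for the twisted truncated sum and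
`G(y) = (-1)^ℓ ∫_{y > t₀ > ⋯ > 0} f_{wordAux acc k}` for the (signed) iterated integral below `y`.
The claim `P_N(ξ y) → G(y)` (for `y < 1`, or `y = 1` and a convergent word) is proved by induction
on
`k` and, for `k = (s, e) :: k'`, on `s`:
* `s ≥ 2` (outer letter `dt/t`): `P_N(ξ y) = ∫₀ʸ P'_N(ξ t) dt/t` for the index `(s-1, e) :: k'`,
  dominated convergence with the majorant `Λ_{(s-1,e)::k'}(t)/t` (integral `∑ ‖T_{(s,e)::k'}‖ < ∞`);
* `s = 1` (outer letter the pole `a = (ξx)⁻¹`, `c = ξ x`): `P_N(ξ y) = ∫₀ʸ c ∑_{j<N-1} (ct)^j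
  Z_{j+1}(k') dt`
  and Abel summation `c ∑_{j<M} (ct)^j Z_{j+1} = c/(1-ct) · (P'_M(ct) - (ct)^M Z_M)`; the kernel
  `c/(1 - ct) = -(t - a)⁻¹` is bounded (`y < 1`, or `c ≠ 1` for a convergent word), `P'_M(ct) →
  G'(t)`
  by induction (`t < 1`), `(ct)^M Z_M → 0`, everything dominated by `2K Λ_{k'}(t)`; dominated
  convergence and the slicing formula `G(y) = ∫₀ʸ -(t-a)⁻¹ G'(t) dt`. -/

/-- **Induction step along the first exponent.** Given the convergence statement for the index
`k` (all accumulated exponents, all `t < 1`), the twisted truncated sums of `(s, e) :: k` converge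
to the signed iterated integral below `y`, for every `s ≥ 1`, `0 < y ≤ 1`, and (`y < 1` or the word
convergent). [cite: Zhao2010, §1 eq. (2)] -/
theorem tendsto_twistedTrunc_cons (k : List (ℕ × Fin 4)) (hk : ∀ p ∈ k, 1 ≤ p.1)
    (IH : ∀ (acc : Fin 4) (t : ℝ), 0 < t → t < 1 →
      Tendsto (fun N : ℕ => ∑ n ∈ MZV.truncSet k.length N,
          (I ^ (acc : ℕ) * (t : ℂ)) ^ (Finset.univ.sup n) * LevelFour.polylogTerm k n) atTop
        (𝓝 ((-1) ^ k.length * ∫ u in {τ : Fin ((LevelFour.wordAux acc k).length) → ℝ | (∀ i, 0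
            < τ i) ∧ (∀ i, τ i < t) ∧ StrictAnti τ},
          levelFourIntegrandC (LevelFour.wordAux acc k) u))) :
    ∀ s : ℕ, 1 ≤ s → ∀ (e acc : Fin 4) (y : ℝ), 0 < y → y ≤ 1 →
      (y < 1 ∨ LevelFour.IsConvergent (LevelFour.wordAux acc ((s, e) :: k))) →
      Tendsto (fun N : ℕ => ∑ n ∈ MZV.truncSet (k.length + 1) N,
          (I ^ (acc : ℕ) * (y : ℂ)) ^ (Finset.univ.sup n) * LevelFour.polylogTerm ((s, e) :: k) n)
        atTop
        (𝓝 ((-1) ^ (k.length + 1) * ∫ u in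
            {τ : Fin ((LevelFour.wordAux acc ((s, e) :: k)).length) → ℝ | (∀ i, 0 < τ i) ∧ (∀ i, τ i
            < y) ∧ StrictAnti τ},
          levelFourIntegrandC (LevelFour.wordAux acc ((s, e) :: k)) u)) := by
  refine Nat.le_induction ?_ ?_
  · /- `s = 1`: the outermost letter is the pole `a = i^{-(acc+e)}`. -/
    intro e acc y hy0 hy1 hconv
    set m : Fin 4 := acc + e with hm
    set c : ℂ := I ^ (m : ℕ) with hc
    have hce : I ^ (acc : ℕ) * I ^ (e : ℕ) = c := by
      rw [hc, hm, Fin.val_add, ← pow_add]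
      conv_lhs => rw [← Nat.mod_add_div ((acc : ℕ) + e) 4, pow_add, pow_mul, Complex.I_pow_four,
        one_pow, mul_one]
    have hc1 : ‖c‖ = 1 := LevelFour.norm_I_pow _
    have hct : ∀ t : ℝ, 0 ≤ t → ‖c * (t : ℂ)‖ = t := fun t ht => by
      rw [norm_mul, hc1, one_mul, Complex.norm_real, Real.norm_eq_abs, abs_of_nonneg ht]
    have hWeq : LevelFour.wordAux acc ((1, e) :: k) = Fin.castSucc (-m) :: LevelFour.wordAux m k :=
      rfl
    have hint := integrableOn_wordAux acc ((1, e) :: k) hy0 hy1 hconv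
    rw [hWeq] at hint
    have hm0 : y < 1 ∨ m ≠ 0 := hconv.imp_right fun h h0 => h.1 (by simp [hWeq, h0])
    -- the kernel `c/(1 - c t)` is bounded on `(0, y)`
    set K : ℝ := (1 - y)⁻¹ + 1 with hK
    have hK0 : 0 ≤ K := add_nonneg (inv_nonneg.2 (sub_nonneg.2 hy1)) zero_le_one
    obtain ⟨δ, hδ0, hδK, hδ⟩ : ∃ δ : ℝ, 0 < δ ∧ δ⁻¹ ≤ K ∧
        ∀ t ∈ Ioo (0 : ℝ) y, δ ≤ ‖1 - c * (t : ℂ)‖ := by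
      rcases hm0 with hy | hm0
      · refine ⟨1 - y, sub_pos.2 hy, le_add_of_nonneg_right zero_le_one, fun t ht => ?_⟩
        exact le_trans (by linarith [ht.2]) (LevelFour.one_sub_le_norm_one_sub_mul hc1 t ht.1.le)
      · refine ⟨1, one_pos, ?_, fun t ht => ?_⟩
        · rw [inv_one, hK]
          exact le_add_of_nonneg_left (inv_nonneg.2 (sub_nonneg.2 hy1))
        · exact LevelFour.one_le_norm_one_sub_I_pow_mul hm0 ht.1.le
    have hker : ∀ t ∈ Ioo (0 : ℝ) y, 1 - c * (t : ℂ) ≠ 0 ∧ ‖c / (1 - c * t)‖ ≤ K := fun t ht => by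
      have h1 := hδ t ht
      refine ⟨norm_pos_iff.1 (hδ0.trans_le h1), ?_⟩
      rw [norm_div, hc1, one_div]
      exact (inv_anti₀ hδ0 h1).trans hδK
    -- the approximants and the limit as functions on `(0, y)`
    set F : ℕ → ℝ → ℂ := fun N t =>
      c * ∑ j ∈ Finset.range (N - 1), (c * (t : ℂ)) ^ j * LevelFour.polylogTrunc k (j + 1)
      with hFdef
    set f : ℝ → ℂ := fun t => c / (1 - c * t) * ((-1) ^ k.length *
      ∫ u in {τ : Fin ((LevelFour.wordAux m k).length) → ℝ | (∀ i, 0 < τ i) ∧ (∀ i, τ i < t)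
          ∧ StrictAnti τ}, levelFourIntegrandC (LevelFour.wordAux m k) u)
      with hfdef
    -- the twisted truncated sum, along the first summation variable
    have hsum : ∀ N : ℕ, ∑ n ∈ MZV.truncSet (k.length + 1) N,
        (I ^ (acc : ℕ) * (y : ℂ)) ^ (Finset.univ.sup n) * LevelFour.polylogTerm ((1, e) :: k) n =
        ∑ j ∈ Finset.range (N - 1),
          (c * y) ^ (j + 1) / ((j : ℂ) + 1) * LevelFour.polylogTrunc k (j + 1) := by
      intro N
      rw [LevelFour.twistedTrunc_cons, Finset.sum_Ico_eq_sum_range]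
      refine Finset.sum_congr rfl fun j _ => ?_
      rw [Nat.add_comm 1 j, show I ^ (acc : ℕ) * (y : ℂ) * I ^ (e : ℕ) = c * y by rw [← hce]; ring]
      push_cast
      ring
    -- ... is the integral of the approximant
    have hF_int : ∀ N : ℕ, ∫ t in Ioo (0 : ℝ) y, F N t = ∑ j ∈ Finset.range (N - 1),
        (c * y) ^ (j + 1) / ((j : ℂ) + 1) * LevelFour.polylogTrunc k (j + 1) := by
      intro N
      simp only [hFdef]
      rw [integral_const_mul, integral_finsetSum _ (fun j _ => ?_)]
      · rw [Finset.mul_sum]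
        refine Finset.sum_congr rfl fun j _ => ?_
        rw [show (fun t : ℝ => (c * (t : ℂ)) ^ j * LevelFour.polylogTrunc k (j + 1)) =
            fun t : ℝ => (c ^ j * LevelFour.polylogTrunc k (j + 1)) * ((t : ℝ) : ℂ) ^ j from
            funext fun t => by ring]
        rw [integral_const_mul, integral_ofReal_pow_Ioo j hy0.le]
        ring
      · exact (Continuous.integrableOn_Icc (by fun_prop)).mono_set Ioo_subset_Icc_self
    have hLHS : ∀ N : ℕ, ∑ n ∈ MZV.truncSet (k.length + 1) N,
        (I ^ (acc : ℕ) * (y : ℂ)) ^ (Finset.univ.sup n) * LevelFour.polylogTerm ((1, e) :: k) n =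
        ∫ t in Ioo (0 : ℝ) y, F N t := fun N => (hsum N).trans (hF_int N).symm
    -- the signed iterated integral is the integral of the limit (slicing)
    have hRHS : (-1 : ℂ) ^ (k.length + 1) *
        ∫ u in {τ : Fin ((LevelFour.wordAux acc ((1, e) :: k)).length) → ℝ | (∀ i, 0 < τ i)
            ∧ (∀ i, τ i < y) ∧ StrictAnti τ},
          levelFourIntegrandC (LevelFour.wordAux acc ((1, e) :: k)) u =
        ∫ t in Ioo (0 : ℝ) y, f t := by
      rw [hWeq, setIntegral_simplexLT_cons _ _ _ hint, ← integral_const_mul]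
      refine setIntegral_congr_fun measurableSet_Ioo fun t _ => ?_
      simp only [hfdef]
      rw [levelFourFactor_castSucc_neg, ← hc]
      ring
    rw [hRHS]
    refine Tendsto.congr (fun N => (hLHS N).symm) ?_
    -- dominated convergence
    have hfin : ∀ᵐ t ∂(volume.restrict (Ioo (0 : ℝ) y)), (∑' n : ↥(mzvIndexSet (List.length k)),
        ENNReal.ofReal ‖LevelFour.polylogTerm k n.1‖ * ENNReal.ofReal (t ^ (Finset.univ.sup n.1)))
        < ⊤ :=
      ae_lt_top' (measurable_Lam k).aemeasurable (ne_of_lt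
        ((lintegral_mono_set (Ioo_subset_Ioo_right hy1)).trans_lt (lintegral_Lam_lt_top k hk)))
    refine tendsto_integral_filter_of_dominated_convergence
      (fun t => (ENNReal.ofReal (2 * K) * (∑' n : ↥(mzvIndexSet (List.length k)),
          ENNReal.ofReal ‖LevelFour.polylogTerm k n.1‖
          * ENNReal.ofReal (t ^ (Finset.univ.sup n.1)))).toReal) ?_ ?_ ?_ ?_
    · refine Eventually.of_forall fun N => Continuous.aestronglyMeasurable ?_
      simp only [hFdef]
      fun_prop
    · refine Eventually.of_forall fun N => ?_
      filter_upwards [ae_restrict_mem measurableSet_Ioo, hfin] with t ht htop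
      have ht0 : 0 ≤ t := ht.1.le
      obtain ⟨hne, hKt⟩ := hker t ht
      rw [ENNReal.toReal_mul, ENNReal.toReal_ofReal (by positivity)]
      set Λt : ℝ≥0∞ := ∑' n : ↥(mzvIndexSet (List.length k)),
        ENNReal.ofReal ‖LevelFour.polylogTerm k n.1‖ * ENNReal.ofReal (t ^ (Finset.univ.sup n.1))
        with hΛt
      have hR : ∑ n ∈ MZV.truncSet k.length (N - 1),
          ‖c * (t : ℂ)‖ ^ (Finset.univ.sup n) * ‖LevelFour.polylogTerm k n‖ ≤ Λt.toReal := by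
        rw [hct t ht0]
        exact sum_le_Lam_toReal k (N - 1) ht0 htop.ne
      cases N with
      | zero =>
        simp only [hFdef, Nat.zero_sub, Finset.range_zero, Finset.sum_empty, mul_zero, norm_zero]
        exact mul_nonneg (mul_nonneg zero_le_two hK0) ENNReal.toReal_nonneg
      | succ N =>
        rw [Nat.add_sub_cancel] at hR
        have hFN : F (N + 1) t = c / (1 - c * t) *
            ((∑ n ∈ MZV.truncSet k.length N,
              (c * (t : ℂ)) ^ (Finset.univ.sup n) * LevelFour.polylogTerm k n) -
              (c * (t : ℂ)) ^ N * LevelFour.polylogTrunc k N) := by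
          rw [← LevelFour.abel_twistedTrunc k (c * t) N, ← mul_assoc, div_mul_cancel₀ _ hne]
          simp only [hFdef, Nat.add_sub_cancel]
        rw [hFN, norm_mul]
        calc ‖c / (1 - c * t)‖ * ‖(∑ n ∈ MZV.truncSet k.length N,
              (c * (t : ℂ)) ^ (Finset.univ.sup n) * LevelFour.polylogTerm k n) -
              (c * (t : ℂ)) ^ N * LevelFour.polylogTrunc k N‖
            ≤ K * (Λt.toReal + Λt.toReal) :=
              mul_le_mul hKt ((norm_sub_le _ _).trans (add_le_add
                ((LevelFour.norm_twistedTrunc_le k N _).trans hR)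
                ((LevelFour.norm_pow_mul_polylogTrunc_le k N (by rw [hct t ht0]; linarith [ht.2]))
                  |>.trans hR))) (norm_nonneg _) hK0
          _ = 2 * K * Λt.toReal := by ring
    · refine integrable_toReal_of_lintegral_ne_top ?_ (ne_of_lt ?_)
      · exact ((measurable_Lam k).const_mul _).aemeasurable
      · rw [lintegral_const_mul _ (measurable_Lam k)]
        exact ENNReal.mul_lt_top ENNReal.ofReal_lt_top
          ((lintegral_mono_set (Ioo_subset_Ioo_right hy1)).trans_lt (lintegral_Lam_lt_top k hk))
    · filter_upwards [ae_restrict_mem measurableSet_Ioo] with t ht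
      obtain ⟨hne, -⟩ := hker t ht
      have ht1 : t < 1 := ht.2.trans_le hy1
      have hP : Tendsto (fun N : ℕ => ∑ n ∈ MZV.truncSet k.length N,
          (c * (t : ℂ)) ^ (Finset.univ.sup n) * LevelFour.polylogTerm k n) atTop
          (𝓝 ((-1) ^ k.length * ∫ u in {τ : Fin ((LevelFour.wordAux m k).length) → ℝ | (∀ i, 0
              < τ i) ∧ (∀ i, τ i < t) ∧ StrictAnti τ},
            levelFourIntegrandC (LevelFour.wordAux m k) u)) := IH m t ht.1 ht1
      have hB : Tendsto (fun N : ℕ => (c * (t : ℂ)) ^ N * LevelFour.polylogTrunc k N) atTop (𝓝 0) :=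
        LevelFour.tendsto_pow_mul_polylogTrunc k (by rw [hct t ht.1.le]; exact ht1)
      have hG : Tendsto (fun N : ℕ => c / (1 - c * t) *
          ((∑ n ∈ MZV.truncSet k.length N,
            (c * (t : ℂ)) ^ (Finset.univ.sup n) * LevelFour.polylogTerm k n) -
            (c * (t : ℂ)) ^ N * LevelFour.polylogTrunc k N)) atTop (𝓝 (f t)) := by
        have := (hP.sub hB).const_mul (c / (1 - c * t))
        rwa [sub_zero] at this
      refine (hG.comp (tendsto_sub_atTop_nat 1)).congr' ?_
      filter_upwards [eventually_ge_atTop 1] with N hN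
      obtain ⟨N, rfl⟩ : ∃ N', N = N' + 1 := ⟨N - 1, by omega⟩
      simp only [Function.comp_apply, Nat.add_sub_cancel]
      rw [← LevelFour.abel_twistedTrunc k (c * t) N, ← mul_assoc, div_mul_cancel₀ _ hne]
      simp only [hFdef, Nat.add_sub_cancel]
  · /- `s → s + 1`: one more outer letter `dt/t`. -/
    intro s hs ihs e acc y hy0 hy1 hconv
    have hks : ∀ p ∈ (s, e) :: k, 1 ≤ p.1 := fun p hp => by
      rcases List.mem_cons.1 hp with rfl | hp
      exacts [hs, hk p hp]
    have hWeq := LevelFour.wordAux_cons_succ acc e k hs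
    have hint := integrableOn_wordAux acc ((s + 1, e) :: k) hy0 hy1 hconv
    rw [hWeq] at hint
    set c : ℂ := I ^ (acc : ℕ) * I ^ (e : ℕ) with hc
    set F : ℕ → ℝ → ℂ := fun N t => ((t⁻¹ : ℝ) : ℂ) *
      ∑ n ∈ MZV.truncSet (k.length + 1) N,
        (I ^ (acc : ℕ) * (t : ℂ)) ^ (Finset.univ.sup n) * LevelFour.polylogTerm ((s, e) :: k) n
      with hFdef
    set f : ℝ → ℂ := fun t => ((t⁻¹ : ℝ) : ℂ) * ((-1) ^ (k.length + 1) *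
      ∫ u in {τ : Fin ((LevelFour.wordAux acc ((s, e) :: k)).length) → ℝ | (∀ i, 0 < τ i)
          ∧ (∀ i, τ i < t) ∧ StrictAnti τ},
        levelFourIntegrandC (LevelFour.wordAux acc ((s, e) :: k)) u) with hfdef
    -- on `(0, y)` the approximant is a polynomial
    have hpoly : ∀ N : ℕ, ∀ t ∈ Ioo (0 : ℝ) y, F N t = ∑ j ∈ Finset.range (N - 1),
        (c ^ (j + 1) * LevelFour.polylogTrunc k (j + 1) / ((j : ℂ) + 1) ^ s) *
          ((t : ℝ) : ℂ) ^ j := by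
      intro N t ht
      have ht0 : (t : ℂ) ≠ 0 := Complex.ofReal_ne_zero.2 ht.1.ne'
      simp only [hFdef]
      rw [LevelFour.twistedTrunc_cons, Finset.mul_sum, Finset.sum_Ico_eq_sum_range]
      refine Finset.sum_congr rfl fun j _ => ?_
      rw [Nat.add_comm 1 j, show I ^ (acc : ℕ) * (t : ℂ) * I ^ (e : ℕ) = c * t by rw [hc]; ring]
      have hj : (j : ℂ) + 1 ≠ 0 := Nat.cast_add_one_ne_zero j
      push_cast
      field_simp
      ring
    have hLHS : ∀ N : ℕ, ∑ n ∈ MZV.truncSet (k.length + 1) N,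
        (I ^ (acc : ℕ) * (y : ℂ)) ^ (Finset.univ.sup n)
            * LevelFour.polylogTerm ((s + 1, e) :: k) n =
        ∫ t in Ioo (0 : ℝ) y, F N t := by
      intro N
      rw [setIntegral_congr_fun measurableSet_Ioo (hpoly N), integral_finsetSum _ fun j _ => ?_]
      · rw [LevelFour.twistedTrunc_cons, Finset.sum_Ico_eq_sum_range]
        refine Finset.sum_congr rfl fun j _ => ?_
        rw [integral_const_mul, integral_ofReal_pow_Ioo j hy0.le, Nat.add_comm 1 j,
          show I ^ (acc : ℕ) * (y : ℂ) * I ^ (e : ℕ) = c * y by rw [hc]; ring]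
        have hj : (j : ℂ) + 1 ≠ 0 := Nat.cast_add_one_ne_zero j
        push_cast
        field_simp
        ring
      · exact (Continuous.integrableOn_Icc (by fun_prop)).mono_set Ioo_subset_Icc_self
    have hRHS : (-1 : ℂ) ^ (k.length + 1) *
        ∫ u in {τ : Fin ((LevelFour.wordAux acc ((s + 1, e) :: k)).length) → ℝ | (∀ i, 0 < τ i)
            ∧ (∀ i, τ i < y) ∧ StrictAnti τ},
          levelFourIntegrandC (LevelFour.wordAux acc ((s + 1, e) :: k)) u =
        ∫ t in Ioo (0 : ℝ) y, f t := by
      rw [hWeq, setIntegral_simplexLT_cons _ _ _ hint, ← integral_const_mul]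
      refine setIntegral_congr_fun measurableSet_Ioo fun t _ => ?_
      simp only [hfdef, levelFourFactor_four]
      ring
    rw [hRHS]
    refine Tendsto.congr (fun N => (hLHS N).symm) ?_
    -- dominated convergence
    have hΛ : ∫⁻ t in Ioo (0 : ℝ) 1, ENNReal.ofReal (1 / t) *
        (∑' n : ↥(mzvIndexSet (List.length (((s, e) :: k)))),
        ENNReal.ofReal ‖LevelFour.polylogTerm (((s, e) :: k)) n.1‖
        * ENNReal.ofReal (t ^ (Finset.univ.sup n.1))) < ⊤ := by
      rw [lintegral_inv_mul_Lam]
      exact tsum_ofReal_norm_polylogTerm_lt_top (by omega) e hk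
    have hfin : ∀ᵐ t ∂(volume.restrict (Ioo (0 : ℝ) y)),
        (∑' n : ↥(mzvIndexSet (List.length (((s, e) :: k)))),
        ENNReal.ofReal ‖LevelFour.polylogTerm (((s, e) :: k)) n.1‖
        * ENNReal.ofReal (t ^ (Finset.univ.sup n.1))) < ⊤ :=
      ae_lt_top' (measurable_Lam _).aemeasurable (ne_of_lt
        ((lintegral_mono_set (Ioo_subset_Ioo_right hy1)).trans_lt (lintegral_Lam_lt_top _ hks)))
    refine tendsto_integral_filter_of_dominated_convergence
      (fun t => (ENNReal.ofReal t⁻¹ * (∑' n : ↥(mzvIndexSet (List.length (((s, e) :: k)))),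
          ENNReal.ofReal ‖LevelFour.polylogTerm (((s, e) :: k)) n.1‖
          * ENNReal.ofReal (t ^ (Finset.univ.sup n.1)))).toReal) ?_ ?_ ?_ ?_
    · refine Eventually.of_forall fun N => ?_
      simp only [hFdef]
      exact ((Complex.continuous_ofReal.measurable.comp measurable_inv).mul
        (Continuous.measurable (by fun_prop))).aestronglyMeasurable
    · refine Eventually.of_forall fun N => ?_
      filter_upwards [ae_restrict_mem measurableSet_Ioo, hfin] with t ht htop
      have ht0 : 0 ≤ t := ht.1.le
      have hw : ‖I ^ (acc : ℕ) * (t : ℂ)‖ = t := by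
        rw [norm_mul, LevelFour.norm_I_pow, one_mul, Complex.norm_real, Real.norm_eq_abs,
          abs_of_nonneg ht0]
      rw [ENNReal.toReal_mul, ENNReal.toReal_ofReal (inv_nonneg.2 ht0)]
      simp only [hFdef]
      rw [norm_mul, Complex.norm_real, Real.norm_eq_abs, abs_of_nonneg (inv_nonneg.2 ht0)]
      refine mul_le_mul_of_nonneg_left ?_ (inv_nonneg.2 ht0)
      refine (LevelFour.norm_twistedTrunc_le ((s, e) :: k) N _).trans ?_
      rw [hw]
      exact sum_le_Lam_toReal ((s, e) :: k) N ht0 htop.ne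
    · refine integrable_toReal_of_lintegral_ne_top ?_ (ne_of_lt ?_)
      · exact (measurable_inv.ennreal_ofReal.mul (measurable_Lam _)).aemeasurable
      · calc ∫⁻ t in Ioo (0 : ℝ) y, ENNReal.ofReal t⁻¹ *
          (∑' n : ↥(mzvIndexSet (List.length (((s, e) :: k)))),
          ENNReal.ofReal ‖LevelFour.polylogTerm (((s, e) :: k)) n.1‖
          * ENNReal.ofReal (t ^ (Finset.univ.sup n.1)))
            ≤ ∫⁻ t in Ioo (0 : ℝ) 1, ENNReal.ofReal t⁻¹ *
                (∑' n : ↥(mzvIndexSet (List.length (((s, e) :: k)))),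
                ENNReal.ofReal ‖LevelFour.polylogTerm (((s, e) :: k)) n.1‖
                * ENNReal.ofReal (t ^ (Finset.univ.sup n.1))) :=
              lintegral_mono_set (Ioo_subset_Ioo_right hy1)
          _ = ∫⁻ t in Ioo (0 : ℝ) 1, ENNReal.ofReal (1 / t) *
              (∑' n : ↥(mzvIndexSet (List.length (((s, e) :: k)))),
              ENNReal.ofReal ‖LevelFour.polylogTerm (((s, e) :: k)) n.1‖
              * ENNReal.ofReal (t ^ (Finset.univ.sup n.1))) := by
              simp_rw [one_div]
          _ < ⊤ := hΛ
    · filter_upwards [ae_restrict_mem measurableSet_Ioo] with t ht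
      simp only [hFdef, hfdef]
      exact (ihs e acc t ht.1 (ht.2.trans_le hy1).le (Or.inl (ht.2.trans_le hy1))).const_mul _

/-- **The twisted truncated sums converge to the iterated integrals below `t < 1`**: for every
index `k` (all `sⱼ ≥ 1`), accumulated exponent `acc` and `0 < t < 1`,
`∑_{N > n₁ > ⋯} (i^{acc} t)^{n₁} T_k(n) → (-1)^ℓ ∫_{t > t₀ > ⋯ > 0} f_{wordAux acc k}` — the
multiple
polylogarithm in one variable is the iterated integral. [cite: Zhao2010, §1 eq. (2)] -/
theorem tendsto_twistedTrunc : ∀ (k : List (ℕ × Fin 4)), (∀ p ∈ k, 1 ≤ p.1) →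
    ∀ (acc : Fin 4) (t : ℝ), 0 < t → t < 1 →
      Tendsto (fun N : ℕ => ∑ n ∈ MZV.truncSet k.length N,
          (I ^ (acc : ℕ) * (t : ℂ)) ^ (Finset.univ.sup n) * LevelFour.polylogTerm k n) atTop
        (𝓝 ((-1) ^ k.length * ∫ u in {τ : Fin ((LevelFour.wordAux acc k).length) → ℝ | (∀ i, 0
            < τ i) ∧ (∀ i, τ i < t) ∧ StrictAnti τ},
          levelFourIntegrandC (LevelFour.wordAux acc k) u))
  | [], _, acc, t, _, _ => by
    have h1 : ∀ N : ℕ, ∑ n ∈ MZV.truncSet ([] : List (ℕ × Fin 4)).length N,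
        (I ^ (acc : ℕ) * (t : ℂ)) ^ (Finset.univ.sup n) * LevelFour.polylogTerm [] n = 1 := by
      intro N
      show ∑ n ∈ MZV.truncSet 0 N,
        (I ^ (acc : ℕ) * (t : ℂ)) ^ (Finset.univ.sup n) * LevelFour.polylogTerm [] n = 1
      simp [MZV.truncSet, polylogTerm_nil]
    have h2 : (-1 : ℂ) ^ ([] : List (ℕ × Fin 4)).length *
        ∫ u in {τ : Fin ((LevelFour.wordAux acc []).length) → ℝ | (∀ i, 0 < τ i) ∧ (∀ i, τ i < t)
            ∧ StrictAnti τ},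
          levelFourIntegrandC (LevelFour.wordAux acc []) u = 1 := by
      show (-1 : ℂ) ^ 0 * ∫ u in {τ : Fin 0 → ℝ | (∀ i, 0 < τ i) ∧ (∀ i, τ i < t)
          ∧ StrictAnti τ}, levelFourProd (n := 0) ([] : List (Fin 5)).get u = 1
      rw [pow_zero, one_mul]
      exact setIntegral_levelFourProd_fin_zero _ t
    rw [h2]
    simp_rw [h1]
    exact tendsto_const_nhds
  | (s, e) :: k, hk, acc, t, ht0, ht1 => by
    have hs : 1 ≤ s := hk (s, e) (by simp)
    have hk' : ∀ p ∈ k, 1 ≤ p.1 := fun p hp => hk p (List.mem_cons_of_mem _ hp)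
    exact tendsto_twistedTrunc_cons k hk' (tendsto_twistedTrunc k hk') s hs e acc t ht0 ht1.le
      (Or.inl ht1)

/-! ### The named fact -/

/-- **The level-4 simplex representations compute the multiple polylogarithm values**
(discharge of the named fact `KZ.levelFourRep_value`): for a convergent index
`k = ((s₁,e₁),…,(s_ℓ,e_ℓ))` (`(s₁, i^{e₁}) ≠ (1, 1)`), the nested partial sums
`∑_{N > n₁ > ⋯ > n_ℓ ≥ 1} ∏ⱼ i^{eⱼnⱼ}/nⱼ^{sⱼ}` converge to
`(-1)^ℓ ∫_{1 > t₀ > ⋯ > 0} ∏ⱼ dtⱼ/(tⱼ - aⱼ')` over the word `0^{s₁-1}a₁ ⋯ 0^{s_ℓ-1}a_ℓ`,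
`aⱼ = (x₁⋯xⱼ)⁻¹` — Zhao 2010, §1 eqs. (1)–(2) (`Li_s(x) = (-1)^ℓ ∫₀¹ (dt/t)^{s₁-1} dt/(t-a₁) ⋯`),
including the conditionally convergent case `s₁ = 1`, `x₁ ≠ 1` (Abel summation in the outermost
variable). [cite: Zhao2010, §1 eq. (2)] -/
theorem levelFourRep_value_holds : levelFourRep_value := by
  intro k hk
  cases k with
  | nil =>
    have h1 : ∀ N : ℕ, LevelFour.polylogTrunc [] N = 1 := fun N => by
      show ∑ n ∈ MZV.truncSet 0 N, LevelFour.polylogTerm [] n = 1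
      simp [MZV.truncSet, polylogTerm_nil]
    have h2 : (-1 : ℂ) ^ ([] : List (ℕ × Fin 4)).length *
        ∫ t in openOrderedSimplex (LevelFour.word []).length,
          levelFourIntegrandC (LevelFour.word []) t = 1 := by
      show (-1 : ℂ) ^ 0 * ∫ u in {τ : Fin 0 → ℝ | (∀ i, 0 < τ i) ∧ (∀ i, τ i < 1)
          ∧ StrictAnti τ}, levelFourProd (n := 0) ([] : List (Fin 5)).get u = 1
      rw [pow_zero, one_mul]
      exact setIntegral_levelFourProd_fin_zero _ 1
    rw [h2]
    refine Tendsto.congr (fun N => (h1 N).symm) tendsto_const_nhds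
  | cons q k =>
    obtain ⟨s, e⟩ := q
    have hs : 1 ≤ s := hk.1 (s, e) (by simp)
    have hk' : ∀ p ∈ k, 1 ≤ p.1 := fun p hp => hk.1 p (List.mem_cons_of_mem _ hp)
    have hconv : LevelFour.IsConvergent (LevelFour.wordAux 0 ((s, e) :: k)) :=
      LevelFour.isConvergent_word hk
    have h := tendsto_twistedTrunc_cons k hk' (tendsto_twistedTrunc k hk') s hs e 0 1 one_pos le_rfl
      (Or.inr hconv)
    have hfun : (fun N : ℕ => ∑ n ∈ MZV.truncSet (k.length + 1) N,
        (I ^ ((0 : Fin 4) : ℕ) * ((1 : ℝ) : ℂ)) ^ (Finset.univ.sup n) *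
          LevelFour.polylogTerm ((s, e) :: k) n) = LevelFour.polylogTrunc ((s, e) :: k) := by
      funext N
      show _ = ∑ n ∈ MZV.truncSet (k.length + 1) N, LevelFour.polylogTerm ((s, e) :: k) n
      exact Finset.sum_congr rfl fun n _ => by simp
    rw [hfun] at h
    exact h

end KZ

end Literature.NumberTheory.Transcendental
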